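import Literature.Barriers.Schanuel.NesterenkoModularScopeTransferToolkit
import Literature.Barriers.Schanuel.NesterenkoModularScopeDiagonal
import Literature.Barriers.Schanuel.NesterenkoModularScopeMahlerProofs
import Literature.RingTheory.MvPolynomial.ConeBezoutCount
import HarnessLib

/-!
# Barrier (Schanuel) `NesterenkoModularScope`: the induction of LNM 1752 Ch. 10 §4 with `z` projectivised, and the reduction of the barrier to Proposition 3.6 — proofs only

Proofs-only sibling of `NesterenkoModularScopeTransfer*.lean`; no definitions, nothing asserted.

With `z` projectivised as the coordinate `x₁` over `ℚ` (transfer principle,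
`NesterenkoModularScopeTransfer*.lean`), Theorem 2.2 of Ch. 10 for the Ramanujan system becomes the
height-free statement

  `T(r)`: `ord I ≤ τ_r (deg I)^{4/(5−r)}` for every homogeneous unmixed `I ⊂ ℚ[x₀, …, x₄]` of rank `r`
  (`dim I = r − 1`), `1 ≤ r ≤ 4`,

and the diagonal multiplicity estimate (DIAG of `NesterenkoModularScopeDiagonal.lean`) is `T(4)` read
through Prop. 4.8 (`ord A(z, P, Q, R) = ord E(ω̂) ≤ ord (E)`, `E` the homogenisation of `A`,
`deg (E) = deg E ≤ 4N`). This file proves: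

* `ordI_le_ideg_of_rank_one` — **`T(1)` with `τ₁ = 1`** (in print the case `r = 1` of §4 needs
  the `D`-property; here a prime of rank `1` either misses the rational point
  `ω̄(0) = (1:0:1:1:1)`, or is its ideal and then contains `x₁ = z`);
* `level_step` — **the induction step of §4**: `T(r−1)` and Proposition 3.6 at level `r` give `T(r)`
  (a deep prime component by Prop. 4.7, the auxiliary `B ∉ 𝔭` of Prop. 3.6, the Bézout step
  Prop. 4.11, and the exponent bookkeeping `(1 + 1/(5−r)) · 4/(6−r) = 4/(5−r)`);
* `diagonalInt_of_prop36`, `nesterenkoModularScope_of_prop36` — **DIAG, hence the barrier, from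
  Proposition 3.6 of Ch. 10 (projectivised) at levels `r = 2, 3, 4`**, stated as an explicit
  hypothesis (what remains to be formalised: Lemmas 3.1–3.5 and the chain construction of §3).

## References

* [NesterenkoPhilippon2001] Yu. V. Nesterenko, P. Philippon (eds.), *Introduction to Algebraic
  Independence Theory*, LNM 1752, Springer 2001, Ch. 10 §2 (Thm 2.1 ⇐ Thm 2.2, p. 153), §3
  Prop. 3.6 (p. 157), §4 (pp. 161–162); Ch. 3 §5 (the same induction for `K = ℚ`, pp. 42–46).
-/

noncomputable section

open Complex MvPolynomial Filter Topology
open Literature.NumberTheory.Transcendental Literature.NumberTheory.Transcendental.Nesterenko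

attribute [local instance] MvPolynomial.gradedAlgebra

namespace Literature.Barriers.Schanuel

namespace Transfer

/-! ### Finiteness of orders along `ω̂` (Mahler) -/

/-- **A non-zero form has finite order along `ω̂`** (Mahler: `z, P, Q, R` are algebraically
independent, `Mahler1969_ramanujan_algIndep_holds`). [cite: NesterenkoPhilippon2001, Ch. 10 §1 Example 3 (p. 151)] -/
theorem ordAlong_ne_top_of_isHomogeneous {G : MvPolynomial (Fin 5) ℂ} {n : ℕ} (hG : G.IsHomogeneous n)
    (h0 : G ≠ 0) : ordAlong G ≠ ⊤ := by
  rw [ordAlong, ne_eq, PowerSeries.order_eq_top, alongSeries]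
  exact Mahler1969_ramanujan_algIndep_holds _ (dehomog_ne_zero_of_isHomogeneous hG h0)

/-- Rational coefficients: a non-zero form has finite order along `ω̂`. [folklore] -/
theorem ordAlongQ_ne_top_of_isHomogeneous {G : Rx 4} {n : ℕ} (hG : G.IsHomogeneous n) (h0 : G ≠ 0) :
    ordAlongQ G ≠ ⊤ := by
  refine ordAlong_ne_top_of_isHomogeneous (hG.map _) ?_
  intro h
  exact h0 (MvPolynomial.map_injective _ (algebraMap ℚ ℂ).injective (by rw [h, map_zero]))

/-- A non-zero homogeneous ideal contains a non-zero form. [folklore] -/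
theorem exists_homogeneous_mem_ne_zero {𝔮 : Ideal (Rx 4)}
    (hhom : 𝔮.IsHomogeneous (homogeneousSubmodule (Fin 5) ℚ)) (hne : 𝔮 ≠ ⊥) :
    ∃ g ∈ 𝔮, ∃ n, g.IsHomogeneous n ∧ g ≠ 0 := by
  classical
  obtain ⟨g, hg, hgne⟩ := Submodule.exists_mem_ne_zero_of_ne_bot hne
  obtain ⟨n, hn⟩ : ∃ n, homogeneousComponent n g ≠ 0 := by
    by_contra h
    push Not at h
    exact hgne (by rw [← sum_homogeneousComponent g]; exact Finset.sum_eq_zero fun n _ => h n)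
  refine ⟨homogeneousComponent n g, ?_, n, homogeneousComponent_isHomogeneous n g, hn⟩
  have := hhom n hg
  rwa [show (DirectSum.decompose (homogeneousSubmodule (Fin 5) ℚ) g n : Rx 4) = homogeneousComponent n g
    from weightedDecomposition.decompose'_apply ℚ (1 : Fin 5 → ℕ) g n] at this

/-- A prime is an associated prime of itself. [folklore] -/
theorem self_mem_associatedPrimes {R : Type*} [CommRing R] {𝔭 : Ideal R} (h𝔭 : 𝔭.IsPrime) :
    𝔭 ∈ 𝔭.associatedPrimes := by
  refine ⟨h𝔭, 1, ?_⟩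
  have hcol : Submodule.colon 𝔭 {(1 : R)} = 𝔭 := by
    ext a
    rw [Submodule.mem_colon_singleton, smul_eq_mul, mul_one]
  rw [hcol, h𝔭.radical]

/-- A prime of rank `≤ 4` of `ℚ[x₀, …, x₄]` is non-zero (`(0)` has rank `5`). [folklore] -/
theorem ne_bot_of_isPrime_of_rank_le {𝔭 : Ideal (Rx 4)} {r : ℕ} (hprime : 𝔭.IsPrime)
    (hunm : IsUnmixedOfRank 𝔭 r) (hr : r ≤ 4) : 𝔭 ≠ ⊥ := by
  intro hbot
  have hdim : ringKrullDim (Rx 4 ⧸ 𝔭) = r := hunm.2 𝔭 (self_mem_associatedPrimes hprime)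
  rw [hbot] at hdim
  have h5 : ringKrullDim (Rx 4 ⧸ (⊥ : Ideal (Rx 4))) = (5 : ℕ) :=
    Literature.RingTheory.MvPolynomial.ringKrullDim_quotient_bot_mvPolynomial
  rw [h5] at hdim
  have h' : ((5 : ℕ) : ℕ∞) = (r : ℕ∞) := WithBot.coe_injective hdim
  have : (5 : ℕ) = r := by exact_mod_cast h'
  omega

/-- **`ord 𝔭 < ∞` for a homogeneous prime of rank `1 ≤ r ≤ 4`** (it contains a non-zero form `C`,
of finite order by Mahler, and `ord 𝔭 ≤ r deg 𝔭 · ord C`). [folklore] -/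
theorem ordI_ne_top_of_isPrime {r : ℕ} {𝔭 : Ideal (Rx 4)} (hr1 : 1 ≤ r) (hr4 : r ≤ 4)
    (hprime : 𝔭.IsPrime) (hhom : 𝔭.IsHomogeneous (homogeneousSubmodule (Fin 5) ℚ))
    (hunm : IsUnmixedOfRank 𝔭 r) : ordI 𝔭 r ≠ ⊤ := by
  obtain ⟨C, hC, n, hChom, hC0⟩ :=
    exists_homogeneous_mem_ne_zero hhom (ne_bot_of_isPrime_of_rank_le hprime hunm hr4)
  obtain ⟨v, hv⟩ := ENat.ne_top_iff_exists.mp (ordAlongQ_ne_top_of_isHomogeneous hChom hC0)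
  have := ordI_le_of_mem_of_ordAlongQ_eq hr1 hr4 hprime hhom hunm hC hChom hv.symm
  exact (this.trans_lt (ENat.coe_lt_top _)).ne

/-- **`ord I < ∞` for a homogeneous unmixed `I` of rank `1 ≤ r ≤ 4`** (Prop. 4.7 3)). [folklore] -/
theorem ordI_ne_top_of_unmixed {r : ℕ} {I : Ideal (Rx 4)} (hr1 : 1 ≤ r) (hr4 : r ≤ 4)
    (hhom : I.IsHomogeneous (homogeneousSubmodule (Fin 5) ℚ)) (hunm : IsUnmixedOfRank I r) :
    ordI I r ≠ ⊤ := by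
  classical
  obtain ⟨t, ht⟩ : ∃ t : Finset (Ideal (Rx 4)), Submodule.IsMinimalPrimaryDecomposition I t :=
    Submodule.IsLasker.exists_isMinimalPrimaryDecomposition (Submodule.isLasker (Rx 4) (Rx 4)) I
  have hle := ordI_le_sum_primaryExponent_smul hr1 hr4 hhom hunm ht
  have hfin : ∑ Q ∈ t, primaryExponent Q • ordI Q.radical r < ⊤ := by
    refine WithTop.sum_lt_top.mpr fun Q hQ => ?_
    obtain ⟨hp, hph, hpu, -, -⟩ := radical_component_facts hhom hunm ht hQ
    rw [nsmul_eq_mul]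
    exact WithTop.mul_lt_top (WithTop.coe_lt_top _) (lt_top_iff_ne_top.mpr (ordI_ne_top_of_isPrime hr1 hr4 hp hph hpu))
  exact (hle.trans_lt hfin).ne

/-! ### `T(1)`: the trivial case of points -/

/-- The constant coefficient of `G(ω̂)` is the value at `ω̄(0) = (1, 0, 1, 1, 1)`. [folklore] -/
theorem coeff_zero_alongSeries (G : MvPolynomial (Fin 5) ℂ) :
    PowerSeries.coeff 0 (alongSeries G) = aeval (nesterenkoOmega 0) G := by
  have h := (hasSum_alongSeries G (z := 0) (by simp)).2
  have h' : HasSum (fun n => PowerSeries.coeff n (alongSeries G) * (0 : ℂ) ^ n)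
      (PowerSeries.coeff 0 (alongSeries G)) := by
    convert hasSum_ite_eq 0 (PowerSeries.coeff 0 (alongSeries G)) using 1
    funext n
    rcases Nat.eq_zero_or_pos n with rfl | hn
    · simp
    · simp [hn.ne']
  exact h'.unique h

/-- A rational form not vanishing at `ω̄(0)` has order `0` along `ω̂`. [folklore] -/
theorem ordAlongQ_eq_zero_of_aeval_ne_zero {G : Rx 4} (h : aeval (nesterenkoOmega 0) G ≠ 0) :
    ordAlongQ G = 0 := by
  rw [ordAlongQ, ordAlong]
  refine le_antisymm ?_ bot_le
  have : PowerSeries.coeff 0 (alongSeries (MvPolynomial.map (algebraMap ℚ ℂ) G)) ≠ 0 := by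
    rwa [coeff_zero_alongSeries, aeval_map_algebraMap_nesterenkoOmega]
  exact_mod_cast PowerSeries.order_le 0 this

/-- The homogeneous ideal of the point `ω̄(0)`: if a homogeneous prime of rank `1` has all its
members vanishing at `ω̄(0) = (1 : 0 : 1 : 1 : 1)` then it contains `x₁`. [folklore] -/
theorem X_one_mem_of_forall_aeval_eq_zero {𝔭 : Ideal (Rx 4)} (hprime : 𝔭.IsPrime)
    (hunm : IsUnmixedOfRank 𝔭 1) (hall : ∀ G ∈ 𝔭, ∀ n, aeval (nesterenkoOmega 0) (homogeneousComponent n G) = 0) :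
    (X 1 : Rx 4) ∈ 𝔭 := by
  -- `𝔭 ≤ 𝔮 := coneIdeal ω̄(0)`, a prime not contained in the maximal ideal... containing `x₁`, missing `x₀`
  set 𝔮 : Ideal (Rx 4) := coneIdeal (nesterenkoOmega 0) with h𝔮
  have hle : 𝔭 ≤ 𝔮 := fun G hG => (mem_coneIdeal_iff _ _).mpr (hall G hG)
  haveI h𝔮p : 𝔮.IsPrime := isPrime_coneIdeal _
  haveI := hprime
  have hX1 : (X 1 : Rx 4) ∈ 𝔮 := by
    rw [h𝔮, mem_coneIdeal_iff]
    intro n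
    rw [homogeneousComponent_of_mem (isHomogeneous_X ℚ 1)]
    split_ifs
    · simp [nesterenkoOmega]
    · exact map_zero _
  have hX0 : (X 0 : Rx 4) ∉ 𝔮 := by
    rw [h𝔮, mem_coneIdeal_iff]
    intro h
    have := h 1
    rw [homogeneousComponent_of_mem (isHomogeneous_X ℚ 0), if_pos rfl] at this
    simp [nesterenkoOmega] at this
  -- the irrelevant ideal `𝔪 = ker(constant coefficient)` is a maximal ideal containing `𝔮`
  set 𝔪 : Ideal (Rx 4) := RingHom.ker (constantCoeff : Rx 4 →+* ℚ) with h𝔪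
  have h𝔪max : 𝔪.IsMaximal := RingHom.ker_isMaximal_of_surjective _ fun q => ⟨C q, constantCoeff_C _ q⟩
  have h𝔮𝔪 : 𝔮 ≤ 𝔪 := by
    intro G hG
    rw [h𝔪, RingHom.mem_ker]
    have h0 := (mem_coneIdeal_iff _ _).mp hG 0
    rw [homogeneousComponent_zero, aeval_C, eq_ratCast, Rat.cast_eq_zero] at h0
    exact h0
  have h𝔪𝔮 : ¬ 𝔪 ≤ 𝔮 := fun h => hX0 (h (by rw [h𝔪, RingHom.mem_ker, constantCoeff_X]))
  -- dimensions: `dim R/𝔭 = 1`, and `𝔭 < 𝔮 < 𝔪` is impossible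
  have hdim𝔭 : ringKrullDim (Rx 4 ⧸ 𝔭) = (1 : ℕ) := hunm.2 𝔭 (self_mem_associatedPrimes hprime)
  by_contra hX1𝔭
  have hne : ¬ 𝔮 ≤ 𝔭 := fun h => hX1𝔭 (h hX1)
  have hlt := Literature.RingTheory.MvPolynomial.ringKrullDim_quotient_sup_lt_of_not_le hdim𝔭 hne
  rw [sup_eq_right.mpr hle] at hlt
  -- so `dim R/𝔮 = 0`
  obtain ⟨d, hd, -⟩ := Literature.RingTheory.MvPolynomial.exists_nat_ringKrullDim_quotient_eq
    (K := ℚ) (m := 5) (I := 𝔮) h𝔮p.ne_top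
  have hd0 : d = 0 := by
    rw [hd] at hlt
    have : (d : ℕ∞) < ((1 : ℕ) : ℕ∞) := WithBot.coe_lt_coe.mp hlt
    have : d < 1 := by exact_mod_cast this
    omega
  rw [hd0] at hd
  have hlt' := Literature.RingTheory.MvPolynomial.ringKrullDim_quotient_sup_lt_of_not_le hd h𝔪𝔮
  rw [sup_eq_right.mpr h𝔮𝔪] at hlt'
  haveI : Nontrivial (Rx 4 ⧸ 𝔪) := Ideal.Quotient.nontrivial_iff.mpr h𝔪max.ne_top
  have hnn : 0 ≤ ringKrullDim (Rx 4 ⧸ 𝔪) := ringKrullDim_nonneg_of_nontrivial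
  have : ringKrullDim (Rx 4 ⧸ 𝔪) < 0 := by exact_mod_cast hlt'
  exact absurd (hnn.trans_lt this) (lt_irrefl _)

/-- **`T(1)` for primes**: `ord 𝔭 ≤ deg 𝔭` for a homogeneous prime of rank `1` (its zeros are
finitely many constant points; the curve `ω̂` has contact of order `≤ 1` with a constant point since
`ω̂₁ = z`). [cite: NesterenkoPhilippon2001, Ch. 10 §4, the case `r = 1` (p. 161), projectivised] -/
theorem ordI_le_ideg_of_isPrime_rank_one {𝔭 : Ideal (Rx 4)} (hprime : 𝔭.IsPrime)
    (hhom : 𝔭.IsHomogeneous (homogeneousSubmodule (Fin 5) ℚ)) (hunm : IsUnmixedOfRank 𝔭 1) :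
    ordI 𝔭 1 ≤ (ideg 𝔭 1 : ℕ∞) := by
  classical
  by_cases hall : ∀ G ∈ 𝔭, ∀ n, aeval (nesterenkoOmega 0) (homogeneousComponent n G) = 0
  · -- `x₁ ∈ 𝔭`, of order `1`
    have hX1 := X_one_mem_of_forall_aeval_eq_zero hprime hunm hall
    have := ordI_le_of_mem_of_ordAlongQ_eq le_rfl (by norm_num) hprime hhom hunm hX1
      (isHomogeneous_X ℚ 1) (v := 1) (by rw [ordAlongQ_X_one]; rfl)
    simpa using this
  · push Not at hall
    obtain ⟨G, hG, n, hn⟩ := hall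
    have hmem : homogeneousComponent n G ∈ 𝔭 := by
      have := hhom n hG
      rwa [show (DirectSum.decompose (homogeneousSubmodule (Fin 5) ℚ) G n : Rx 4) = homogeneousComponent n G
        from weightedDecomposition.decompose'_apply ℚ (1 : Fin 5 → ℕ) G n] at this
    have := ordI_le_of_mem_of_ordAlongQ_eq le_rfl (by norm_num) hprime hhom hunm hmem
      (homogeneousComponent_isHomogeneous n G) (v := 0) (ordAlongQ_eq_zero_of_aeval_ne_zero hn)
    simp only [mul_zero, Nat.cast_zero, nonpos_iff_eq_zero] at this
    rw [this]; exact bot_le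

/-- **`T(1)`: `ord I ≤ deg I`** for every homogeneous unmixed `I ⊂ ℚ[x₀, …, x₄]` of rank `1`
(Prop. 4.7 1), 3) to pass to the prime components). [cite: NesterenkoPhilippon2001, Ch. 10 §4 (p. 161), projectivised] -/
theorem ordI_le_ideg_of_rank_one {I : Ideal (Rx 4)} (hhom : I.IsHomogeneous (homogeneousSubmodule (Fin 5) ℚ))
    (hunm : IsUnmixedOfRank I 1) : ordI I 1 ≤ (ideg I 1 : ℕ∞) := by
  classical
  obtain ⟨t, ht⟩ : ∃ t : Finset (Ideal (Rx 4)), Submodule.IsMinimalPrimaryDecomposition I t :=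
    Submodule.IsLasker.exists_isMinimalPrimaryDecomposition (Submodule.isLasker (Rx 4) (Rx 4)) I
  have hle := ordI_le_sum_primaryExponent_smul le_rfl (by norm_num) hhom hunm ht
  have h47 := (NesterenkoPhilippon2001_ch3_prop_4_7_holds 4 1 I le_rfl (by norm_num) hhom hunm t ht
    (nesterenkoOmega 0) (nesterenkoOmega_ne_zero 0)).1
  refine hle.trans ?_
  rw [← h47]
  push_cast
  refine Finset.sum_le_sum fun Q hQ => ?_
  obtain ⟨hp, hph, hpu, -, -⟩ := radical_component_facts hhom hunm ht hQ
  rw [nsmul_eq_mul]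
  gcongr
  exact ordI_le_ideg_of_isPrime_rank_one hp hph hpu


/-! ### The induction step of §4 -/

/-- Superadditivity used with Prop. 4.7 1): `∑ k_j d_j^e ≤ (∑ k_j d_j)^e` for `e ≥ 1`, `k_j ≥ 1`,
`d_j ≥ 0`. [folklore] -/
theorem sum_mul_rpow_le_rpow_sum {ι : Type*} (t : Finset ι) (k : ι → ℕ) (d : ι → ℝ) {e : ℝ}
    (he : 1 ≤ e) (hk : ∀ i ∈ t, 1 ≤ k i) (hd : ∀ i ∈ t, 0 ≤ d i) :
    ∑ i ∈ t, (k i : ℝ) * d i ^ e ≤ (∑ i ∈ t, (k i : ℝ) * d i) ^ e := by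
  set D : ℝ := ∑ i ∈ t, (k i : ℝ) * d i with hD
  have hD0 : 0 ≤ D := Finset.sum_nonneg fun i hi => by have := hk i hi; have := hd i hi; positivity
  have hdle : ∀ i ∈ t, d i ≤ D := fun i hi => by
    calc d i ≤ (k i : ℝ) * d i := le_mul_of_one_le_left (hd i hi) (by exact_mod_cast hk i hi)
      _ ≤ D := Finset.single_le_sum (f := fun j => (k j : ℝ) * d j)
          (fun j hj => by have := hk j hj; have := hd j hj; positivity) hi
  have he0 : 0 ≤ e - 1 := by linarith
  have hne : e ≠ 0 := ne_of_gt (lt_of_lt_of_le one_pos he)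
  calc ∑ i ∈ t, (k i : ℝ) * d i ^ e = ∑ i ∈ t, (k i : ℝ) * d i * d i ^ (e - 1) := by
        refine Finset.sum_congr rfl fun i hi => ?_
        rcases (hd i hi).eq_or_lt with h0 | hpos
        · rw [← h0, Real.zero_rpow hne]; simp
        · rw [mul_assoc, ← Real.rpow_one_add' hpos.le (by linarith), add_sub_cancel]
    _ ≤ ∑ i ∈ t, (k i : ℝ) * d i * D ^ (e - 1) := by
        refine Finset.sum_le_sum fun i hi => mul_le_mul_of_nonneg_left
          (Real.rpow_le_rpow (hd i hi) (hdle i hi) he0) ?_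
        have := hk i hi; have := hd i hi; positivity
    _ = D * D ^ (e - 1) := by rw [← Finset.sum_mul]
    _ = D ^ e := by
        rcases hD0.eq_or_lt with h0 | hpos
        · rw [← h0, Real.zero_rpow hne]; simp
        · rw [← Real.rpow_one_add' hpos.le (by linarith), add_sub_cancel]

/-- **LNM 1752 Ch. 10 §4, the induction step, with `z` projectivised.** Let `2 ≤ r ≤ 4`. Suppose
`T(r−1)`: `ord J ≤ τ' (deg J)^{e'}`, `e' = 4/(6−r)`, for homogeneous unmixed `J` of rank `r − 1`;
and Proposition 3.6 at level `r`: every homogeneous prime `𝔭` of rank `r` with `ord 𝔭 ≥ 3 r deg 𝔭`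
admits homogeneous `A ∈ 𝔭`, `B ∉ 𝔭` with `1 ≤ deg B ≤ λ (deg 𝔭)^{1/(5−r)}` and `ord A(ω̂) < ord B(ω̂)`.
Then `T(r)` holds with `τ = max(3r, τ'λ^{e'} + 1)`: for a counterexample `I`, Prop. 4.7 gives a prime
component `𝔭` that is one (`∑ k_j d_j^e ≤ (deg I)^e`), Prop. 3.6 the form `B`, Prop. 4.11 an unmixed
`J` of rank `r − 1` with `deg J ≤ deg 𝔭 deg B`, `ord J ≥ ord 𝔭`, and `T(r−1)` the bound
`ord 𝔭 ≤ τ'(λ (deg 𝔭)^{1 + 1/(5−r)})^{4/(6−r)} = τ'λ^{e'} (deg 𝔭)^{4/(5−r)}`, a contradiction.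
[cite: NesterenkoPhilippon2001, Ch. 10 §4 (pp. 161–162)] -/
theorem level_step {r : ℕ} (hr2 : 2 ≤ r) (hr4 : r ≤ 4) {τ' lam e' : ℝ} (hτ' : 0 ≤ τ') (hlam : 0 ≤ lam)
    (he' : e' = 4 / (6 - r : ℝ))
    (IH : ∀ J : Ideal (Rx 4), J.IsHomogeneous (homogeneousSubmodule (Fin 5) ℚ) →
      IsUnmixedOfRank J (r - 1) → ∀ n : ℕ, ordI J (r - 1) = n → (n : ℝ) ≤ τ' * (ideg J (r - 1) : ℝ) ^ e')
    (P36 : ∀ 𝔭 : Ideal (Rx 4), 𝔭.IsPrime → 𝔭.IsHomogeneous (homogeneousSubmodule (Fin 5) ℚ) →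
      IsUnmixedOfRank 𝔭 r → ((3 * r * ideg 𝔭 r : ℕ) : ℕ∞) ≤ ordI 𝔭 r →
      ∃ (A B : Rx 4) (a d : ℕ), A ∈ 𝔭 ∧ A.IsHomogeneous a ∧ B ∉ 𝔭 ∧ B.IsHomogeneous d ∧ 1 ≤ d ∧
        (d : ℝ) ≤ lam * (ideg 𝔭 r : ℝ) ^ (1 / (5 - r : ℝ)) ∧ ordAlongQ A < ordAlongQ B) :
    ∀ I : Ideal (Rx 4), I.IsHomogeneous (homogeneousSubmodule (Fin 5) ℚ) → IsUnmixedOfRank I r →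
      ∀ n : ℕ, ordI I r = n →
        (n : ℝ) ≤ max (3 * r : ℝ) (τ' * lam ^ e' + 1) * (ideg I r : ℝ) ^ (4 / (5 - r : ℝ)) := by
  classical
  have hr1 : 1 ≤ r := by omega
  set e : ℝ := 4 / (5 - r : ℝ) with he
  set τ : ℝ := max (3 * r : ℝ) (τ' * lam ^ e' + 1) with hτ
  have h5r : (0 : ℝ) < 5 - r := by
    have : (r : ℝ) ≤ 4 := by exact_mod_cast hr4
    linarith
  have h6r : (0 : ℝ) < 6 - r := by linarith
  have h1r : (1 : ℝ) ≤ r := by exact_mod_cast hr1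
  have he1 : 1 ≤ e := by rw [he, le_div_iff₀ h5r]; linarith
  have he'0 : 0 ≤ e' := by rw [he']; positivity
  have hτ3 : (3 * r : ℝ) ≤ τ := le_max_left _ _
  have hττ' : τ' * lam ^ e' + 1 ≤ τ := le_max_right _ _
  have hτ0 : 0 ≤ τ := le_trans (by positivity) hτ3
  -- the key exponent identity `(1 + 1/(5-r)) e' = e`
  have hexp : (1 + 1 / (5 - r : ℝ)) * e' = e := by
    rw [he', he]; field_simp; ring
  -- (★) every homogeneous PRIME of rank `r` obeys the bound
  have prime_case : ∀ 𝔭 : Ideal (Rx 4), 𝔭.IsPrime → 𝔭.IsHomogeneous (homogeneousSubmodule (Fin 5) ℚ) →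
      IsUnmixedOfRank 𝔭 r → ∀ n : ℕ, ordI 𝔭 r = n → (n : ℝ) ≤ τ * (ideg 𝔭 r : ℝ) ^ e := by
    intro 𝔭 hp hph hpu n hn
    by_contra hcon
    push Not at hcon
    set dp : ℝ := (ideg 𝔭 r : ℝ) with hdp
    have hdp1 : (1 : ℝ) ≤ dp := by
      rw [hdp]; exact_mod_cast one_le_ideg_of_isPrime NesterenkoPhilippon2001_ch3_prop_4_4_holds hr1 hr4 hp hph hpu
    have hdpe : dp ≤ dp ^ e := by
      calc dp = dp ^ (1 : ℝ) := (Real.rpow_one _).symm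
        _ ≤ dp ^ e := Real.rpow_le_rpow_of_exponent_le hdp1 he1
    -- depth: `ord 𝔭 ≥ 3 r deg 𝔭`
    have hdeep : ((3 * r * ideg 𝔭 r : ℕ) : ℕ∞) ≤ ordI 𝔭 r := by
      rw [hn]
      have : (3 * r * ideg 𝔭 r : ℝ) ≤ n := by
        calc (3 * r * ideg 𝔭 r : ℝ) = 3 * r * dp := by rw [hdp]
          _ ≤ τ * dp := mul_le_mul_of_nonneg_right hτ3 (by linarith)
          _ ≤ τ * dp ^ e := mul_le_mul_of_nonneg_left hdpe hτ0
          _ ≤ n := hcon.le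
      exact_mod_cast this
    obtain ⟨A, B, a, d, hA, hAhom, hB, hBhom, hd, hdle, hAB⟩ := P36 𝔭 hp hph hpu hdeep
    obtain ⟨J, hJhom, hJunm, -, hJdeg, hJord⟩ :=
      exists_bezout_of_ordAlongQ_lt hr2 hr4 hp hph hpu hBhom hd hB hA hAhom hAB
    obtain ⟨nJ, hnJ⟩ := ENat.ne_top_iff_exists.mp (ordI_ne_top_of_unmixed (r := r - 1) (by omega) (by omega) hJhom hJunm)
    have hIH := IH J hJhom hJunm nJ hnJ.symm
    -- `n ≤ nJ ≤ τ' (dp d)^{e'} ≤ τ' λ^{e'} dp^e`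
    have h1 : (n : ℝ) ≤ nJ := by
      have : (n : ℕ∞) ≤ nJ := by rw [← hn, hnJ]; exact hJord
      exact_mod_cast this
    have h2 : (ideg J (r - 1) : ℝ) ≤ dp * d := by rw [hdp]; exact_mod_cast hJdeg
    have h3 : (ideg J (r - 1) : ℝ) ^ e' ≤ (dp * (lam * dp ^ (1 / (5 - r : ℝ)))) ^ e' := by
      refine Real.rpow_le_rpow (by positivity) (h2.trans ?_) he'0
      exact mul_le_mul_of_nonneg_left hdle (by linarith)
    have h4 : (dp * (lam * dp ^ (1 / (5 - r : ℝ)))) ^ e' = lam ^ e' * dp ^ e := by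
      have hdp0 : 0 ≤ dp := by linarith
      rw [show dp * (lam * dp ^ (1 / (5 - r : ℝ))) = lam * (dp * dp ^ (1 / (5 - r : ℝ))) by ring,
        Real.mul_rpow hlam (by positivity), ← hexp, Real.rpow_mul hdp0]
      congr 1
      rcases hdp0.eq_or_lt with h0 | hpos
      · exfalso; rw [← h0] at hdp1; linarith
      · rw [← Real.rpow_one_add' hpos.le (by positivity)]
    have h5 : (n : ℝ) ≤ τ' * lam ^ e' * dp ^ e := by
      calc (n : ℝ) ≤ nJ := h1
        _ ≤ τ' * (ideg J (r - 1) : ℝ) ^ e' := hIH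
        _ ≤ τ' * (dp * (lam * dp ^ (1 / (5 - r : ℝ)))) ^ e' := mul_le_mul_of_nonneg_left h3 hτ'
        _ = τ' * lam ^ e' * dp ^ e := by rw [h4]; ring
    have h6 : τ * dp ^ e < τ' * lam ^ e' * dp ^ e := hcon.trans_le h5
    have h7 : (τ' * lam ^ e' + 1) * dp ^ e ≤ τ * dp ^ e := mul_le_mul_of_nonneg_right hττ' (by positivity)
    have h8 : 0 < dp ^ e := by positivity
    nlinarith
  -- the general unmixed `I`: Prop. 4.7 and superadditivity
  intro I hhom hunm n hn
  obtain ⟨t, ht⟩ : ∃ t : Finset (Ideal (Rx 4)), Submodule.IsMinimalPrimaryDecomposition I t :=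
    Submodule.IsLasker.exists_isMinimalPrimaryDecomposition (Submodule.isLasker (Rx 4) (Rx 4)) I
  have hle := ordI_le_sum_primaryExponent_smul hr1 hr4 hhom hunm ht
  have h47 := (NesterenkoPhilippon2001_ch3_prop_4_7_holds 4 r I hr1 hr4 hhom hunm t ht
    (nesterenkoOmega 0) (nesterenkoOmega_ne_zero 0)).1
  -- finite orders of the components
  have hfin : ∀ Q ∈ t, ∃ nQ : ℕ, ordI Q.radical r = nQ := fun Q hQ => by
    obtain ⟨hp, hph, hpu, -, -⟩ := radical_component_facts hhom hunm ht hQ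
    exact (ENat.ne_top_iff_exists.mp (ordI_ne_top_of_isPrime hr1 hr4 hp hph hpu)).imp fun _ h => h.symm
  choose! nQ hnQ using hfin
  have hsum : (n : ℝ) ≤ ∑ Q ∈ t, (primaryExponent Q : ℝ) * nQ Q := by
    have h1 : (n : ℕ∞) ≤ ∑ Q ∈ t, primaryExponent Q • ordI Q.radical r := hn ▸ hle
    have h2 : ∑ Q ∈ t, primaryExponent Q • ordI Q.radical r = ((∑ Q ∈ t, primaryExponent Q * nQ Q : ℕ) : ℕ∞) := by
      push_cast
      exact Finset.sum_congr rfl fun Q hQ => by rw [hnQ Q hQ, nsmul_eq_mul]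
    rw [h2] at h1
    have h3 : n ≤ ∑ Q ∈ t, primaryExponent Q * nQ Q := by exact_mod_cast h1
    exact_mod_cast h3
  calc (n : ℝ) ≤ ∑ Q ∈ t, (primaryExponent Q : ℝ) * nQ Q := hsum
    _ ≤ ∑ Q ∈ t, (primaryExponent Q : ℝ) * (τ * (ideg Q.radical r : ℝ) ^ e) := by
        refine Finset.sum_le_sum fun Q hQ => mul_le_mul_of_nonneg_left ?_ (by positivity)
        obtain ⟨hp, hph, hpu, -, -⟩ := radical_component_facts hhom hunm ht hQ
        exact prime_case _ hp hph hpu _ (hnQ Q hQ)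
    _ = τ * ∑ Q ∈ t, (primaryExponent Q : ℝ) * (ideg Q.radical r : ℝ) ^ e := by
        rw [Finset.mul_sum]; exact Finset.sum_congr rfl fun Q _ => by ring
    _ ≤ τ * (∑ Q ∈ t, (primaryExponent Q : ℝ) * (ideg Q.radical r : ℝ)) ^ e := by
        refine mul_le_mul_of_nonneg_left (sum_mul_rpow_le_rpow_sum t _ _ he1 ?_ ?_) hτ0
        · intro Q hQ; exact (radical_component_facts hhom hunm ht hQ).2.2.2.2
        · intro Q _; positivity
    _ = τ * (ideg I r : ℝ) ^ e := by
        congr 2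
        rw [← h47]; push_cast; rfl

/-! ### From `T(4)` to the diagonal multiplicity estimate -/

/-- Homogenisation of `A ∈ ℤ[z, x₁, x₂, x₃]` in degree `n ≥ deg A`: the form
`x₀ⁿ A(x₁/x₀, …, x₄/x₀) ∈ ℚ[x₀, …, x₄]`, its dehomogenisation over `ℂ` is `A`.
[cite: NesterenkoPhilippon2001, Ch. 10 §2, `P = x₀^{deg A} A(x/x₀)` (p. 153)] -/
theorem exists_homogenization_dehomog (A : MvPolynomial (Fin 4) ℤ) {n : ℕ} (hn : A.totalDegree ≤ n) :
    ∃ E : Rx 4, E.IsHomogeneous n ∧ (A ≠ 0 → E ≠ 0) ∧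
      dehomog (MvPolynomial.map (algebraMap ℚ ℂ) E) = MvPolynomial.map (Int.castRingHom ℂ) A := by
  classical
  let lift : (Fin 4 →₀ ℕ) → (Fin 5 →₀ ℕ) := fun d => Finsupp.cons (n - d.degree) d
  have htail : ∀ d, Finsupp.tail (lift d) = d := fun d => by simp [lift, Finsupp.tail_cons]
  have hlift_inj : ∀ d d', lift d = lift d' → d = d' := fun d d' h => by
    have := congrArg Finsupp.tail h; rwa [htail, htail] at this
  have hdeg : ∀ d ∈ A.support, (lift d).degree = n := fun d hd => by
    have h1 : d.degree ≤ n := (le_totalDegree hd).trans hn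
    rw [degree_cons]; omega
  let E : Rx 4 := ∑ d ∈ A.support, monomial (lift d) ((A.coeff d : ℤ) : ℚ)
  refine ⟨E, ?_, ?_, ?_⟩
  · exact IsHomogeneous.sum A.support (fun d => monomial (lift d) ((A.coeff d : ℤ) : ℚ)) n
      fun d hd => isHomogeneous_monomial _ (hdeg d hd)
  · intro hA0 hE0
    obtain ⟨d, hd⟩ := exists_coeff_ne_zero hA0
    have hdsup : d ∈ A.support := mem_support_iff.mpr hd
    have hcoeff : coeff (lift d) E = ((A.coeff d : ℤ) : ℚ) := by
      simp only [E, coeff_sum, coeff_monomial]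
      rw [Finset.sum_eq_single d]
      · rw [if_pos rfl]
      · intro d' _ hne
        rw [if_neg]
        exact fun h => hne (hlift_inj _ _ h)
      · exact fun h => absurd hdsup h
    rw [hE0, coeff_zero] at hcoeff
    exact hd (by exact_mod_cast hcoeff.symm)
  · simp only [E, map_sum, map_monomial, eq_ratCast]
    rw [show (∑ x ∈ A.support, monomial (lift x) ((((A.coeff x : ℤ) : ℚ) : ℂ))) =
        ∑ x ∈ A.support, monomial (lift x) ((A.coeff x : ℤ) : ℂ) from
      Finset.sum_congr rfl fun x _ => by push_cast; rfl]
    rw [show dehomog (∑ x ∈ A.support, monomial (lift x) ((A.coeff x : ℤ) : ℂ)) =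
        ∑ x ∈ A.support, dehomog (monomial (lift x) ((A.coeff x : ℤ) : ℂ)) from map_sum (bind₁ _) _ _]
    simp only [dehomog_monomial, htail]
    conv_rhs => rw [A.as_sum, map_sum]
    refine Finset.sum_congr rfl fun d _ => ?_
    rw [map_monomial]; rfl

/-- `deg A ≤ ∑ᵢ deg_{xᵢ} A`. [folklore] -/
theorem totalDegree_le_sum_degreeOf {σ R : Type*} [Fintype σ] [CommSemiring R] (A : MvPolynomial σ R) :
    A.totalDegree ≤ ∑ i, A.degreeOf i := by
  classical
  rw [totalDegree]
  refine Finset.sup_le fun s hs => ?_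
  rw [Finsupp.sum_fintype _ _ (fun _ => rfl)]
  exact Finset.sum_le_sum fun i _ => monomial_le_degreeOf i hs

/-- The order of a power series is unchanged by an injective change of scalars. [folklore] -/
theorem order_map_of_injective {R S : Type*} [Semiring R] [Semiring S] (f : R →+* S)
    (hf : Function.Injective f) (φ : PowerSeries R) : (φ.map f).order = φ.order := by
  refine le_antisymm ?_ (PowerSeries.le_order_map f)
  rcases eq_or_ne φ 0 with rfl | hφ
  · simp
  · have h := PowerSeries.coeff_order hφ
    obtain ⟨n, hn⟩ := ENat.ne_top_iff_exists.mp (mt PowerSeries.order_eq_top.mp hφ)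
    rw [← hn]
    refine PowerSeries.order_le _ ?_
    rw [PowerSeries.coeff_map]
    rw [← hn, ENat.toNat_coe] at h
    exact fun h0 => h (hf (by rw [h0, map_zero]))

/-- **`T(4)` ⇒ the diagonal multiplicity estimate (DIAG)** through Prop. 4.8: for
`A ∈ ℤ[z, x̲] ∖ 0` with `deg_z A, deg_{xᵢ} A ≤ N`, the homogenisation `E` has `deg (E) = deg A ≤ 4N`
and `ord A(z, P, Q, R) = ord E(ω̂) ≤ ord (E) ≤ τ (deg E)⁴ ≤ 256 τ N⁴`.
[cite: NesterenkoPhilippon2001, Ch. 10 §2, proof of Thm 2.1 from Thm 2.2 (p. 153)] -/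
theorem diagonalInt_of_level_four {τ : ℝ} (hτ : 0 ≤ τ)
    (T4 : ∀ I : Ideal (Rx 4), I.IsHomogeneous (homogeneousSubmodule (Fin 5) ℚ) → IsUnmixedOfRank I 4 →
      ∀ n : ℕ, ordI I 4 = n → (n : ℝ) ≤ τ * (ideg I 4 : ℝ) ^ (4 / (5 - 4 : ℝ))) :
    ∃ c N₀ : ℕ, ∀ N : ℕ, N₀ ≤ N → ∀ A : MvPolynomial (Fin 4) ℤ, A ≠ 0 →
      (∀ i, A.degreeOf i ≤ N) → (ramanujanComposite A).order ≤ ((c * N ^ 4 : ℕ) : ℕ∞) := by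
  refine ⟨⌈256 * τ⌉₊, 0, fun N _ A hA0 hdeg => ?_⟩
  set n := A.totalDegree with hndef
  have hn4 : n ≤ 4 * N := by
    calc n ≤ ∑ i, A.degreeOf i := totalDegree_le_sum_degreeOf A
      _ ≤ ∑ _i : Fin 4, N := Finset.sum_le_sum fun i _ => hdeg i
      _ = 4 * N := by simp
  -- the order of the composite, over `ℂ`
  have hordC : (ramanujanComposite A).order = (ramanujanComposite (MvPolynomial.map (Int.castRingHom ℂ) A)).order := by
    rw [ramanujanComposite_map, order_map_of_injective _ (RingHom.injective_int _)]
  rcases Nat.eq_zero_or_pos n with hn0 | hnpos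
  · -- `A` is a non-zero constant: order `0`
    obtain ⟨a, ha⟩ : ∃ a, A = MvPolynomial.C a := ⟨_, totalDegree_eq_zero_iff_eq_C.mp (hndef ▸ hn0)⟩
    have ha0 : a ≠ 0 := fun h => hA0 (by rw [ha, h, map_zero])
    have : (ramanujanComposite A).order = 0 := by
      rw [ha, ramanujanComposite, MvPolynomial.aeval_C, ← PowerSeries.C_eq_algebraMap]
      refine le_antisymm ?_ bot_le
      exact_mod_cast PowerSeries.order_le 0 (by simpa [PowerSeries.coeff_C] using ha0)
    rw [this]; exact bot_le
  · obtain ⟨E, hEhom, hEne, hEdeh⟩ := exists_homogenization_dehomog A le_rfl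
    have hE0 : E ≠ 0 := hEne hA0
    -- `ord A(z,P,Q,R) = ord E(ω̂)`
    have hordE : ordAlongQ E = (ramanujanComposite A).order := by
      rw [ordAlongQ, ordAlong, alongSeries, hEdeh, hordC]
    -- `ord E(ω̂) ≤ ord (E) ≤ τ (deg E)^4`
    have h1 : ordAlongQ E ≤ ordI (Ideal.span {E}) 4 := ordAlongQ_le_ordI_span_singleton hE0 hEhom hnpos
    have hunit : ¬ IsUnit E := by
      intro hu
      have h0 := (MvPolynomial.isUnit_iff_totalDegree_of_isReduced.mp hu).2
      rw [hEhom.totalDegree hE0] at h0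
      omega
    have hunm : IsUnmixedOfRank (Ideal.span {E}) 4 := PhilipponMain.isUnmixedOfRank_span_singleton hE0 hunit
    have hhomI := Literature.RingTheory.MvPolynomial.isHomogeneous_span_singleton hEhom
    obtain ⟨n₄, hn₄⟩ := ENat.ne_top_iff_exists.mp (ordI_ne_top_of_unmixed (r := 4) (by norm_num) le_rfl hhomI hunm)
    have h2 := T4 _ hhomI hunm n₄ hn₄.symm
    rw [ideg_span_singleton hE0 hEhom hnpos] at h2
    have h3 : (n₄ : ℝ) ≤ ⌈256 * τ⌉₊ * N ^ 4 := by
      calc (n₄ : ℝ) ≤ τ * (n : ℝ) ^ (4 / (5 - 4 : ℝ)) := h2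
        _ = τ * (n : ℝ) ^ (4 : ℕ) := by norm_num
        _ ≤ τ * ((4 * N : ℕ) : ℝ) ^ (4 : ℕ) := by
            refine mul_le_mul_of_nonneg_left (pow_le_pow_left₀ (by positivity) (by exact_mod_cast hn4) 4) hτ
        _ = 256 * τ * (N : ℝ) ^ 4 := by push_cast; ring
        _ ≤ ⌈256 * τ⌉₊ * (N : ℝ) ^ 4 := mul_le_mul_of_nonneg_right (Nat.le_ceil _) (by positivity)
    have h4 : n₄ ≤ ⌈256 * τ⌉₊ * N ^ 4 := by exact_mod_cast h3
    rw [← hordE]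
    calc ordAlongQ E ≤ ordI (Ideal.span {E}) 4 := h1
      _ = n₄ := hn₄.symm
      _ ≤ ((⌈256 * τ⌉₊ * N ^ 4 : ℕ) : ℕ∞) := by exact_mod_cast h4

/-! ### The barrier from Proposition 3.6 of Ch. 10 -/

/-- **DIAG from Proposition 3.6 of LNM 1752 Ch. 10 (projectivised) at levels `r = 2, 3, 4`.**
The hypothesis is the existence, for every homogeneous prime `𝔭 ⊂ ℚ[x₀, …, x₄]` of rank `r` whose
order along `ω̂` is at least `3 r deg 𝔭`, of homogeneous `A ∈ 𝔭`, `B ∉ 𝔭` with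
`1 ≤ deg B ≤ λ (deg 𝔭)^{1/(5−r)}` and `ord A(ω̂) < ord B(ω̂)` (in print `B = (TA)²`, `A = TⁱE`, with
(59) `deg_x B ≤ √τ (deg 𝔭)^{1/(m+1−r)}` and (61) `‖B‖_ω̄ ≤ ρ`). The induction runs `T(1)`
(`ordI_le_ideg_of_rank_one`) → `T(2)` → `T(3)` → `T(4)` (`level_step`) → DIAG
(`diagonalInt_of_level_four`). [cite: NesterenkoPhilippon2001, Ch. 10 Prop. 3.6 (p. 157), §4 (pp. 161–162), Thm 1.3 (p. 151)] -/
theorem diagonalInt_of_prop36 {lam : ℝ} (hlam : 0 ≤ lam)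
    (P36 : ∀ r : ℕ, 2 ≤ r → r ≤ 4 → ∀ 𝔭 : Ideal (Rx 4), 𝔭.IsPrime →
      𝔭.IsHomogeneous (homogeneousSubmodule (Fin 5) ℚ) → IsUnmixedOfRank 𝔭 r →
      ((3 * r * ideg 𝔭 r : ℕ) : ℕ∞) ≤ ordI 𝔭 r →
      ∃ (A B : Rx 4) (a d : ℕ), A ∈ 𝔭 ∧ A.IsHomogeneous a ∧ B ∉ 𝔭 ∧ B.IsHomogeneous d ∧ 1 ≤ d ∧
        (d : ℝ) ≤ lam * (ideg 𝔭 r : ℝ) ^ (1 / (5 - r : ℝ)) ∧ ordAlongQ A < ordAlongQ B) :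
    ∃ c N₀ : ℕ, ∀ N : ℕ, N₀ ≤ N → ∀ A : MvPolynomial (Fin 4) ℤ, A ≠ 0 →
      (∀ i, A.degreeOf i ≤ N) → (ramanujanComposite A).order ≤ ((c * N ^ 4 : ℕ) : ℕ∞) := by
  -- `T(1)`
  have T1 : ∀ J : Ideal (Rx 4), J.IsHomogeneous (homogeneousSubmodule (Fin 5) ℚ) →
      IsUnmixedOfRank J (2 - 1) → ∀ n : ℕ, ordI J (2 - 1) = n →
        (n : ℝ) ≤ 1 * (ideg J (2 - 1) : ℝ) ^ (4 / (6 - 2 : ℝ)) := by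
    intro J hJ hJu n hn
    have h := ordI_le_ideg_of_rank_one hJ hJu
    rw [show (2 - 1 : ℕ) = 1 from rfl] at hn
    rw [hn] at h
    have h' : n ≤ ideg J 1 := by exact_mod_cast h
    rw [show (4 / (6 - 2 : ℝ)) = (1 : ℕ) by norm_num, Real.rpow_natCast, pow_one, one_mul]
    exact_mod_cast h'
  -- `T(2)`, `T(3)`, `T(4)`
  have T2 := level_step (r := 2) le_rfl (by norm_num) zero_le_one hlam rfl T1 (P36 2 le_rfl (by norm_num))
  set τ₂ : ℝ := max (3 * (2 : ℕ) : ℝ) (1 * lam ^ (4 / (6 - (2 : ℕ) : ℝ)) + 1) with hτ₂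
  have hτ₂ : 0 ≤ τ₂ := le_trans (by norm_num) (le_max_left _ _)
  have T2' : ∀ J : Ideal (Rx 4), J.IsHomogeneous (homogeneousSubmodule (Fin 5) ℚ) →
      IsUnmixedOfRank J (3 - 1) → ∀ n : ℕ, ordI J (3 - 1) = n →
        (n : ℝ) ≤ τ₂ * (ideg J (3 - 1) : ℝ) ^ (4 / (6 - 3 : ℝ)) := by
    intro J hJ hJu n hn
    have := T2 J hJ hJu n hn
    rwa [show (4 / (5 - (2 : ℕ) : ℝ)) = 4 / (6 - 3 : ℝ) by norm_num] at this
  have T3 := level_step (r := 3) (by norm_num) (by norm_num) hτ₂ hlam rfl T2' (P36 3 (by norm_num) (by norm_num))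
  set τ₃ : ℝ := max (3 * (3 : ℕ) : ℝ) (τ₂ * lam ^ (4 / (6 - (3 : ℕ) : ℝ)) + 1) with hτ₃
  have hτ₃ : 0 ≤ τ₃ := le_trans (by norm_num) (le_max_left _ _)
  have T3' : ∀ J : Ideal (Rx 4), J.IsHomogeneous (homogeneousSubmodule (Fin 5) ℚ) →
      IsUnmixedOfRank J (4 - 1) → ∀ n : ℕ, ordI J (4 - 1) = n →
        (n : ℝ) ≤ τ₃ * (ideg J (4 - 1) : ℝ) ^ (4 / (6 - 4 : ℝ)) := by
    intro J hJ hJu n hn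
    have := T3 J hJ hJu n hn
    rwa [show (4 / (5 - (3 : ℕ) : ℝ)) = 4 / (6 - 4 : ℝ) by norm_num] at this
  have T4 := level_step (r := 4) (by norm_num) le_rfl hτ₃ hlam rfl T3' (P36 4 (by norm_num) le_rfl)
  set τ₄ : ℝ := max (3 * (4 : ℕ) : ℝ) (τ₃ * lam ^ (4 / (6 - (4 : ℕ) : ℝ)) + 1) with hτ₄
  have hτ₄ : 0 ≤ τ₄ := le_trans (by norm_num) (le_max_left _ _)
  exact diagonalInt_of_level_four hτ₄ (fun I hI hIu n hn => by
    have := T4 I hI hIu n hn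
    rwa [show (4 / (5 - (4 : ℕ) : ℝ)) = 4 / (5 - 4 : ℝ) by norm_num] at this)

/-- **The barrier `NesterenkoModularScope` (Nesterenko 1996, Ch. 3 Thm 1.1) from Proposition 3.6
of Ch. 10, projectivised** (everything else — Props. 4.4, 4.7, 4.8, 4.11, 4.13, Cor. 4.9, 4.10 of
Ch. 3, the `D`-property, Philippon's criterion, Lemmas 2.2, 3.1, 3.4 of Ch. 3 — being proved in
the tree). [cite: NesterenkoPhilippon2001, Ch. 3 Theorem 1.1 (p. 27); Ch. 10 Prop. 3.6 (p. 157)] -/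
theorem nesterenkoModularScope_of_prop36 {lam : ℝ} (hlam : 0 ≤ lam)
    (P36 : ∀ r : ℕ, 2 ≤ r → r ≤ 4 → ∀ 𝔭 : Ideal (Rx 4), 𝔭.IsPrime →
      𝔭.IsHomogeneous (homogeneousSubmodule (Fin 5) ℚ) → IsUnmixedOfRank 𝔭 r →
      ((3 * r * ideg 𝔭 r : ℕ) : ℕ∞) ≤ ordI 𝔭 r →
      ∃ (A B : Rx 4) (a d : ℕ), A ∈ 𝔭 ∧ A.IsHomogeneous a ∧ B ∉ 𝔭 ∧ B.IsHomogeneous d ∧ 1 ≤ d ∧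
        (d : ℝ) ≤ lam * (ideg 𝔭 r : ℝ) ^ (1 / (5 - r : ℝ)) ∧ ordAlongQ A < ordAlongQ B) :
    NesterenkoModularScope :=
  nesterenkoModularScope_of_prop_4_11_of_diagonalInt NesterenkoPhilippon2001_ch3_prop_4_11_holds
    (diagonalInt_of_prop36 hlam P36)

end Transfer

end Literature.Barriers.Schanuel

end
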